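import Literature.NumberTheory.DiophantineGeometry.AbcDepthCensus

/-!
# A certified census of abc triples by 5-depth in boxes `c ≤ N` — witness lists

Companion of the enumeration checkers (`AbcDepthCensus*.lean`).  The enumerations certify that a list
`Lm` CONTAINS every abc triple of a cell `{ω₅ ≥ K}` in a box (`members_complete_of_checkTurboChunks`,
`hits_complete`, …); the converse — every listed triple IS an abc triple of the cell, and is (or is not) a
hit — is a finite check of the list alone, done here once and for all by two executable tests with
soundness theorems:

* `memberWitnessOK K W` — for each entry `(a, b, c, ps)`: `0 < a`, `0 < b`, `a + b = c`, `gcd(a,b) = 1`,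
  and `ps` is a duplicate-free list of at least `K` primes whose fifth powers each divide `a`, `b` or
  `c`; `memberWitnessOK_sound`: every entry is an abc triple with `ω₅(abc) ≥ K`;
* `noHitOK L` — for each `(a, b, c)`: `c ≤ radL a · radL b · radL c` (trial-division radicals);
  `noHitOK_sound`: no listed abc triple is a hit (`c ≤ rad(abc)`).

No axiom beyond `propext`, `Classical.choice`, `Quot.sound`; the evaluations (`decide` / `native_decide`)
live with the consumers (`Summits/ABC/ABC/Theorems/IneffectiveSubspaceDeepRegimeABCCensus*.lean`).
Source: this project; the facts certified are finite computations.
-/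

namespace Literature.NumberTheory.DiophantineGeometry.DepthCensus

/-! ## Members with their deep primes -/

/-- **Witness test for cell members.** Each entry `(a, b, c, ps)`: an abc triple (`0 < a`, `0 < b`,
`a + b = c`, `gcd(a,b) = 1`) with a duplicate-free list `ps` of `≥ K` primes, `p⁵ ∣ a`, `b` or `c` for
each. [folklore] -/
def memberWitnessOK (K : ℕ) (W : List (ℕ × ℕ × ℕ × List ℕ)) : Bool :=
  W.all fun w => decide (0 < w.1) && decide (0 < w.2.1) && decide (w.1 + w.2.1 = w.2.2.1) &&
    (Nat.gcd w.1 w.2.1 == 1) && decide (K ≤ w.2.2.2.length) && decide w.2.2.2.Nodup &&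
    w.2.2.2.all (fun p => decide p.Prime &&
      (decide (p ^ 5 ∣ w.1) || decide (p ^ 5 ∣ w.2.1) || decide (p ^ 5 ∣ w.2.2.1)))

/-- Distinct primes whose fifth powers divide `n` are counted by `ω₅(n)`. [folklore] -/
theorem length_le_depth_of_forall {n : ℕ} (hn : n ≠ 0) (l : List ℕ) (hl : l.Nodup)
    (h : ∀ p ∈ l, p.Prime ∧ p ^ 5 ∣ n) :
    l.length ≤ (n.primeFactors.filter (fun p => 5 ≤ n.factorization p)).card := by
  rw [← List.toFinset_card_of_nodup hl]
  exact Finset.card_le_card fun p hp => by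
    obtain ⟨hpr, hdvd⟩ := h p (List.mem_toFinset.mp hp)
    rw [Finset.mem_filter, Nat.mem_primeFactors]
    exact ⟨⟨hpr, dvd_trans (dvd_pow_self p (by norm_num)) hdvd, hn⟩,
      (hpr.pow_dvd_iff_le_factorization hn).mp hdvd⟩

/-- **Soundness of the member witness test**: every entry is an abc triple of depth `ω₅ ≥ K`.
[folklore] -/
theorem memberWitnessOK_sound {K : ℕ} {W : List (ℕ × ℕ × ℕ × List ℕ)} (h : memberWitnessOK K W = true)
    {a b c : ℕ} {ps : List ℕ} (hw : (a, b, c, ps) ∈ W) :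
    IsABCTriple a b c ∧
      K ≤ ((a * b * c).primeFactors.filter (fun p => 5 ≤ (a * b * c).factorization p)).card := by
  rw [memberWitnessOK, List.all_eq_true] at h
  have hw' := h _ hw
  simp only [Bool.and_eq_true, decide_eq_true_eq, beq_iff_eq, List.all_eq_true, Bool.or_eq_true] at hw'
  obtain ⟨⟨⟨⟨⟨⟨ha, hb⟩, hsum⟩, hcop⟩, hK⟩, hnd⟩, hps⟩ := hw'
  have habc : IsABCTriple a b c := ⟨ha, hb, hsum, hcop⟩
  refine ⟨habc, hK.trans (length_le_depth_of_forall (by rw [← hsum]; positivity) ps hnd ?_)⟩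
  intro p hp
  obtain ⟨hpr, hdvd⟩ := hps p hp
  refine ⟨hpr, ?_⟩
  rcases hdvd with (h | h) | h
  · exact dvd_trans h (dvd_mul_of_dvd_left (dvd_mul_right a b) c)
  · exact dvd_trans h (dvd_mul_of_dvd_left (dvd_mul_left b a) c)
  · exact dvd_trans h (dvd_mul_left c (a * b))

/-! ## Listed triples that are not hits -/

/-- **No-hit test**: `c ≤ radL a · radL b · radL c` for every listed `(a, b, c)`. [folklore] -/
def noHitOK (L : List (ℕ × ℕ × ℕ)) : Bool :=
  L.all fun t => decide (t.2.2 ≤ radL t.1 * radL t.2.1 * radL t.2.2)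

/-- **Soundness of the no-hit test**: a listed abc triple has `c ≤ rad(abc)` (it is not a hit), in either
orientation of the listing. [folklore] -/
theorem noHitOK_sound {L : List (ℕ × ℕ × ℕ)} (h : noHitOK L = true) {a b c : ℕ} (habc : IsABCTriple a b c)
    (hmem : (a, b, c) ∈ L ∨ (b, a, c) ∈ L) : c ≤ rad a b c := by
  rw [noHitOK, List.all_eq_true] at h
  rw [← radL_mul_eq_rad habc]
  rcases hmem with hm | hm
  · simpa using h _ hm
  · have := h _ hm
    simp only [decide_eq_true_eq] at this
    calc c ≤ radL b * radL a * radL c := this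
      _ = radL a * radL b * radL c := by ring

end Literature.NumberTheory.DiophantineGeometry.DepthCensus
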